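import Summits.QuantumFields.BalabanUV.Beta.EriceRemainderEnclosureHistoryAutonomyComparisonLoadBudget

/-!
# EriceRemainderEnclosureHistoryAutonomyComparisonLoadBudgetWindow — (E65a) THE WINDOW LOAD BUDGET: along every box solution of an isotone memory with floor
# dominated by a profile `L ≥ 0`, at EVERY scale `j ≥ 1` the loads `x_k = k·L_k·h_k³∕2` satisfy **`Σ_{k≤j} x_k·S_{k,j}∕j + Σ_{k>j} x_k·S_{k,j}∕k ≤ 1∕2`**,
# `S_{k,j} = Σ_{l<j} √(k∕(k+l+1))` — the budget read off the WHOLE window of `j` increments below scale `j` (each increment reads every age, each read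
# bounded through the level concavity from the age's OWN scale), instead of `j` copies of the last increment ((E64i)).  It dominates (E64i) termwise
# (§3: `old weight ≤ √2·new weight`), sharpens the single-age bound `x_k ≤ √2∕2` to **`x_k ≤ k∕(2S_{k,k})`** (`= 0.707, 0.656, 0.639, 0.630, 0.625 …` for
# `k = 1, 2, 3, 4, 5`, `→ (√2+1)∕4 = 0.6036`), and lowers the admissible uniform load of a tower of ratio `R` by a third (`R = 10`: `0.449 → 0.299`;
# `R = 30`: `0.562 → 0.401`; `R = 2`: `0.171 → 0.107`) — under it the slack system of (E64e) has value `≤ 0.87` on EVERY three-age set and room factor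
# `≥ 1.6` on towers of every ratio `≥ 2` and every height (numerics, `HOME/…/g58/e65/README.md`)

Cell `pub-balaban`, β-function sub-cell, BINDER row D4 «RemainderConst leaves for Bałaban's split» (`HOME/BINDER-OWNERS.md`; owner lineage `b2b-balaban-beta-an4`;
this file by co-owner #2 lineage `b2b-balaban-beta-d4-p2`, generation 58), β-FLOW TEAM duty (1), FREEZE (0) honoured (def-free; (E58b)'s `mul_invSq_add_le` ∕
`mul_sqrt_le_read`, (E48a)'s `strictAnti_of_memFlow`, node U2's `invSq_eq_of_memFlow` ∕ `drive` ∕ `seqBox_shift` BY NAME; nothing restated).  Sequel of (E64i)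
`…ComparisonLoadBudget` (the budget from ONE increment: `j·Σ_k L_k·h_{j+k} ≤ 1∕h_j²`).

HONEST FRAMING (page 1, verbatim and binding).  *"Discharging BetaPertH makes Bałaban's UV stability UNCONDITIONAL — a real constructive-QFT result; it is
NOT the continuum limit and NOT the Clay problem."*  THIS FILE DISCHARGES NOTHING OF THE KIND.  Elementary real analysis about ABSTRACT functionals on a box
]0,γ]^ℕ with displayed floors, profiles and signs — hypotheses of a census, not facts; the form, signs, ages and moments of Bałaban's (1.22) limit functional
are NOT PRINTED ([I] p. 298; GAPS G-t4-U2-1∕-2) and NOT asserted.  Row D4 class UNCHANGED (critical-path width 0; instance 0∕1; D4 DISCHARGE NO DATE).  HONEST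
DEPENDENCY: continuum YM on T⁴ ⇐ BetaPertH ∧ nine spine estimates (0/9 proved); BetaPertH ⇐ (D1) ∧ (D4) ∧ CAP+tail; G-an2-4 gates asym, D1 and NE2/3/4.

THE POINT (census sense (α); the COMPARISON column, conjecture (E58′), route (C) of `HOME/…/g57/e64/README.md`).  (E64e) reduces comparison for ANY finite age
set to a certificate for the slack system with loads `x_j`; the loads of a real trajectory are jointly constrained, and the strength of that constraint is
what decides how much room the finite-dimensional programme has.  (E64i) read the level at scale `j` as `j` copies of the LAST increment below `j`
(`a_j ≥ j·D_{j−1} ≥ j·Σ_k L_k·h_{j+k}`) and compared `h_{j+k}` with `h_j`.  Here the level is read as the SUM of ALL `j` increments (`a_j − a_0 = Σ_{i<j} D_i`,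
`D_i ≥ Σ_k L_k·h_{i+1+k}` by domination), and each read `h_{i+1+k}` is compared with the coupling AT THE AGE'S OWN SCALE through the level concavity
(`h_m ≥ √(k∕m)·h_k` for `m ≥ k`, (E58b) `mul_sqrt_le_read`): `1∕h_j² ≥ Σ_k L_k·h_k·S_{k,j}` (§1).  Converting `L_k·h_k = 2x_k·a_k∕k` with `a_k∕a_j ≥ k∕j`
(`k ≤ j`, concavity) and `a_k ≥ a_j` (`k > j`) gives the budget (§2).  Against (E64i)'s weights `√(k∕j)` ∕ `j∕k` (right side `√2∕2`) the new weights
`S_{k,j}∕max(k,j)` (right side `1∕2`) are larger by the factor `2(√2−1)·√2 = 1.17` on the diagonal, `→ √2` for old ages on young scales and `→ 2√2` for young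
ages on old scales (§3 proves `≥ 1∕√2` of the old weight uniformly, i.e. domination).  Consequences (numerics, README): the exact LP of (E64e) with the
minimal couplings `(k′∕(k′+j))²` stays `≤ 0.868` over ALL three-age sets and all budgeted loads (the region `r₁₂·r₂₃ > 36`, `min rᵢ < 14` left open by
(E64h) and d4-p3's (P3·T1) included), and on geometric towers of every ratio `R ≥ 2` the uniform budgeted loads could be multiplied by `≥ 1.63` before the
LP value reached `1` at any height `≤ 25` — the margin a general certificate construction can spend on the lattice defects of the couplings.  NOT CLAIMED:
a certificate for every profile; anything printed.

WHAT IS PROVED ([folklore]; 0 `def`, 0 sorry).  §1 `readWindow_nonneg`, **`sum_mul_readWindow_le_invSq`** (`Σ_k L_k·h_k·S_{k,j} ≤ 1∕h_j²`).  §2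
**`load_budget_window`** (`Σ_{k<K} L_k·k·h_k³·W_j(k) ≤ 1`, `W_j(k) = S_{k,j}∕j` (`k ≤ j`), `S_{k,j}∕k` (`k > j`)), **`load_le_readWindow`** (`L_k·h_k³·S_{k,k} ≤ 1`,
i.e. `x_k ≤ k∕(2S_{k,k})`).  §3 `sqrt_le_readWindow_summand`, `mul_sqrt_le_readWindow`, **`weight_le_sqrt_two_mul_window_weight`** (domination of (E64i)'s
weights: §2 implies (E64i)'s `load_budget` termwise).
-/
noncomputable section
open Finset Set

namespace Summit.QuantumFields.BalabanUV.Beta.EriceRemainderEnclosureHistoryAutonomyComparisonLoadBudgetWindow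

open Literature.MathematicalPhysics.QuantumFieldTheory.Balaban1983to89
open Literature.MathematicalPhysics.QuantumFieldTheory.Balaban1983to89.T4BetaStationary
open Literature.MathematicalPhysics.QuantumFieldTheory.Balaban1983to89.T4BetaFlowWellPosed
open Summit.QuantumFields.BalabanUV.Beta.EriceRemainderEnclosureHistoryAutonomyOrder (strictAnti_of_memFlow)
open Summit.QuantumFields.BalabanUV.Beta.EriceRemainderEnclosureHistoryAutonomyComparisonAffineProfile (mul_invSq_add_le mul_sqrt_le_read)

variable {B : (ℕ → ℝ) → ℝ} {γ b y : ℝ} {L : ℕ → ℝ} {K : ℕ} {h : ℕ → ℝ}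

/-! ## §1 The whole read window drives the level -/

/-- The read window sum `S_{k,j} = Σ_{l<j} √(k∕(k+l+1))` is non-negative. [folklore] -/
theorem readWindow_nonneg (k j : ℕ) : 0 ≤ ∑ l ∈ range j, Real.sqrt ((k : ℝ) / ((k : ℝ) + l + 1)) :=
  sum_nonneg fun _ _ => Real.sqrt_nonneg _

/-- **THE WHOLE READ WINDOW DRIVES THE LEVEL.**  `B` isotone with floor `b > 0`, dominated by the profile `L ≥ 0` (`Σ_{k<K} L_k·u_k ≤ B u` on the box);
along every box solution `h` from every pin `y > 0`, for every scale `j`: **`Σ_{k<K} L_k·h_k·S_{k,j} ≤ 1∕h_j²`**, `S_{k,j} = Σ_{l<j} √(k∕(k+l+1))` — the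
level at `j` is the pin level plus ALL `j` increments `B(h(l+1+·)) ≥ Σ_k L_k·h_{l+1+k}` (`l < j`), and each read satisfies `h_{k+l+1} ≥ √(k∕(k+l+1))·h_k`
(level concavity from the age's own scale, (E58b) `mul_sqrt_le_read`). [folklore] -/
theorem sum_mul_readWindow_le_invSq (hmono : ∀ u v : ℕ → ℝ, SeqBox γ u → SeqBox γ v → (∀ j, u j ≤ v j) → B u ≤ B v)
    (hL : ∀ k, 0 ≤ L k) (hb : 0 < b) (hlo : ∀ u, SeqBox γ u → b ≤ B u) (hdom : ∀ u, SeqBox γ u → ∑ k ∈ range K, L k * u k ≤ B u)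
    (hy : 0 < y) (hh : SeqBox γ h) (hf : MemFlow B y h) (j : ℕ) :
    ∑ k ∈ range K, L k * h k * ∑ l ∈ range j, Real.sqrt ((k : ℝ) / ((k : ℝ) + l + 1)) ≤ 1 / h j ^ 2 := by
  rw [invSq_eq_of_memFlow hf j]
  -- the driving sum dominates the profile reads of every increment
  have hdrive : ∑ l ∈ range j, ∑ k ∈ range K, L k * h (l + 1 + k) ≤ drive B h j := by
    unfold drive
    exact sum_le_sum fun l _ => hdom _ (seqBox_shift hh (l + 1))
  -- each read is bounded below through the concavity from the age's own scale
  have hterm : ∀ k ∈ range K, L k * h k * ∑ l ∈ range j, Real.sqrt ((k : ℝ) / ((k : ℝ) + l + 1)) ≤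
      ∑ l ∈ range j, L k * h (l + 1 + k) := by
    intro k _
    rw [mul_sum]
    refine sum_le_sum fun l _ => ?_
    have hr := mul_sqrt_le_read hmono hb hlo hy hh hf k (l + 1)
    rw [show k + (l + 1) = l + 1 + k by omega] at hr
    have e : ((k : ℝ) + ((l + 1 : ℕ) : ℝ)) = (k : ℝ) + l + 1 := by push_cast; ring
    rw [e] at hr
    calc L k * h k * Real.sqrt ((k : ℝ) / ((k : ℝ) + l + 1)) = L k * (Real.sqrt ((k : ℝ) / ((k : ℝ) + l + 1)) * h k) := by ring
      _ ≤ L k * h (l + 1 + k) := mul_le_mul_of_nonneg_left hr (hL k)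
  have hy2 : 0 ≤ 1 / y ^ 2 := by positivity
  calc ∑ k ∈ range K, L k * h k * ∑ l ∈ range j, Real.sqrt ((k : ℝ) / ((k : ℝ) + l + 1))
      ≤ ∑ k ∈ range K, ∑ l ∈ range j, L k * h (l + 1 + k) := sum_le_sum hterm
    _ = ∑ l ∈ range j, ∑ k ∈ range K, L k * h (l + 1 + k) := sum_comm
    _ ≤ drive B h j := hdrive
    _ ≤ 1 / y ^ 2 + drive B h j := by linarith

/-! ## §2 THE WINDOW LOAD BUDGET at every scale, and the single-age bound -/

/-- **THE WINDOW LOAD BUDGET.**  `B` isotone with floor `b > 0`, dominated by the profile `L ≥ 0`; along every box solution `h` from every pin `y > 0`, for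
every scale `j ≥ 1`: **`Σ_{k<K} L_k·k·h_k³·W_j(k) ≤ 1`** with `W_j(k) = S_{k,j}∕j` for `k ≤ j` and `S_{k,j}∕k` for `k > j`, `S_{k,j} = Σ_{l<j} √(k∕(k+l+1))` —
i.e. with the loads `x_k = k·L_k·h_k³∕2`: `Σ_{k≤j} x_k·S_{k,j}∕j + Σ_{k>j} x_k·S_{k,j}∕k ≤ 1∕2`.  From §1: `L_k·h_k = (L_k·k·h_k³)·(a_k∕k)` (`a = 1∕h²`), with
`a_k∕a_j ≥ k∕j` for `k ≤ j` (concavity, (E58b) `mul_invSq_add_le`) and `a_k ≥ a_j` for `k > j` (the trajectory decreases).  ONE age `k = j`: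
`x_j ≤ j∕(2S_{j,j})` (`load_le_readWindow`); the weights dominate (E64i)'s (§3). [folklore] -/
theorem load_budget_window (hmono : ∀ u v : ℕ → ℝ, SeqBox γ u → SeqBox γ v → (∀ j, u j ≤ v j) → B u ≤ B v) (hL : ∀ k, 0 ≤ L k)
    (hb : 0 < b) (hlo : ∀ u, SeqBox γ u → b ≤ B u) (hdom : ∀ u, SeqBox γ u → ∑ k ∈ range K, L k * u k ≤ B u) (hy : 0 < y)
    (hh : SeqBox γ h) (hf : MemFlow B y h) {j : ℕ} (hj : 1 ≤ j) :
    ∑ k ∈ range K, L k * k * h k ^ 3 *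
      (if k ≤ j then (∑ l ∈ range j, Real.sqrt ((k : ℝ) / ((k : ℝ) + l + 1))) / j
        else (∑ l ∈ range j, Real.sqrt ((k : ℝ) / ((k : ℝ) + l + 1))) / k) ≤ 1 := by
  have hjr : (0 : ℝ) < j := by exact_mod_cast hj
  have hhj := (hh j).1
  have hanti := (strictAnti_of_memFlow hb hlo hh hf).antitone
  have hwin := sum_mul_readWindow_le_invSq hmono hL hb hlo hdom hy hh hf j
  -- termwise: L_k·k·h_k³·W_j(k) ≤ h_j²·(L_k·h_k·S_{k,j})
  have hterm : ∀ k ∈ range K, L k * k * h k ^ 3 *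
      (if k ≤ j then (∑ l ∈ range j, Real.sqrt ((k : ℝ) / ((k : ℝ) + l + 1))) / j
        else (∑ l ∈ range j, Real.sqrt ((k : ℝ) / ((k : ℝ) + l + 1))) / k) ≤
      h j ^ 2 * (L k * h k * ∑ l ∈ range j, Real.sqrt ((k : ℝ) / ((k : ℝ) + l + 1))) := by
    intro k _
    set S : ℝ := ∑ l ∈ range j, Real.sqrt ((k : ℝ) / ((k : ℝ) + l + 1)) with hS_def
    have hS : 0 ≤ S := readWindow_nonneg k j
    have hhk := (hh k).1
    have hLS : 0 ≤ L k * h k * S := mul_nonneg (mul_nonneg (hL k) hhk.le) hS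
    by_cases hkj : k ≤ j
    · rw [if_pos hkj]
      -- level concavity: k·h_k² ≤ j·h_j²
      have hconc : (k : ℝ) * h k ^ 2 ≤ (j : ℝ) * h j ^ 2 := by
        have hc := mul_invSq_add_le hmono hb hlo hy hh hf k (j - k)
        have e : k + (j - k) = j := by omega
        have e' : (k : ℝ) + ((j - k : ℕ) : ℝ) = j := by exact_mod_cast e
        rw [e, e'] at hc
        have := mul_le_mul_of_nonneg_right hc (by positivity : (0 : ℝ) ≤ h j ^ 2 * h k ^ 2)
        have e1 : (k : ℝ) * (1 / h j ^ 2) * (h j ^ 2 * h k ^ 2) = (k : ℝ) * h k ^ 2 := by field_simp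
        have e2 : (j : ℝ) * (1 / h k ^ 2) * (h j ^ 2 * h k ^ 2) = (j : ℝ) * h j ^ 2 := by field_simp
        rw [e1, e2] at this; exact this
      -- hence k·h_k³∕j ≤ h_j²·h_k
      have hkey : (k : ℝ) * h k ^ 3 / j ≤ h j ^ 2 * h k := by
        rw [div_le_iff₀ hjr]
        have := mul_le_mul_of_nonneg_right hconc hhk.le
        calc (k : ℝ) * h k ^ 3 = (k : ℝ) * h k ^ 2 * h k := by ring
          _ ≤ (j : ℝ) * h j ^ 2 * h k := this
          _ = h j ^ 2 * h k * j := by ring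
      calc L k * k * h k ^ 3 * (S / j) = L k * S * ((k : ℝ) * h k ^ 3 / j) := by ring
        _ ≤ L k * S * (h j ^ 2 * h k) := mul_le_mul_of_nonneg_left hkey (mul_nonneg (hL k) hS)
        _ = h j ^ 2 * (L k * h k * S) := by ring
    · rw [if_neg hkj]
      have hjk : j < k := Nat.lt_of_not_le hkj
      have hkr : (0 : ℝ) < k := by exact_mod_cast (Nat.zero_le j).trans_lt hjk
      have hkj' : h k ≤ h j := hanti hjk.le
      have h2 : h k ^ 2 ≤ h j ^ 2 := pow_le_pow_left₀ hhk.le hkj' 2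
      calc L k * k * h k ^ 3 * (S / k) = h k ^ 2 * (L k * h k * S) := by field_simp
        _ ≤ h j ^ 2 * (L k * h k * S) := mul_le_mul_of_nonneg_right h2 hLS
  calc ∑ k ∈ range K, L k * k * h k ^ 3 *
        (if k ≤ j then (∑ l ∈ range j, Real.sqrt ((k : ℝ) / ((k : ℝ) + l + 1))) / j
          else (∑ l ∈ range j, Real.sqrt ((k : ℝ) / ((k : ℝ) + l + 1))) / k)
      ≤ ∑ k ∈ range K, h j ^ 2 * (L k * h k * ∑ l ∈ range j, Real.sqrt ((k : ℝ) / ((k : ℝ) + l + 1))) := sum_le_sum hterm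
    _ = h j ^ 2 * ∑ k ∈ range K, L k * h k * ∑ l ∈ range j, Real.sqrt ((k : ℝ) / ((k : ℝ) + l + 1)) := by rw [mul_sum]
    _ ≤ h j ^ 2 * (1 / h j ^ 2) := mul_le_mul_of_nonneg_left hwin (by positivity)
    _ = 1 := by field_simp

/-- **THE SINGLE-AGE LOAD BOUND FROM THE WHOLE WINDOW**: along every box solution from every pin of an isotone memory with floor dominated by the
profile `L ≥ 0`, for every age `k < K`: **`L_k·h_k³·S_{k,k} ≤ 1`**, `S_{k,k} = Σ_{l<k} √(k∕(k+l+1))` — i.e. `x_k = k·L_k·h_k³∕2 ≤ k∕(2S_{k,k})`, which is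
`√2∕2 = 0.7071` at `k = 1` ((E58b)∕(E63c) recovered) and `0.6563, 0.6389, 0.6301, 0.6248, 0.6142, 0.6089` at `k = 2, 3, 4, 5, 10, 20`, decreasing to
`(√2+1)∕4 = 0.6036` (`S_{k,k}∕k → ∫₁² t^{−1∕2} dt = 2(√2−1)`).  WHATEVER the other ages and sizes. [folklore] -/
theorem load_le_readWindow (hmono : ∀ u v : ℕ → ℝ, SeqBox γ u → SeqBox γ v → (∀ j, u j ≤ v j) → B u ≤ B v) (hL : ∀ k, 0 ≤ L k)
    (hb : 0 < b) (hlo : ∀ u, SeqBox γ u → b ≤ B u) (hdom : ∀ u, SeqBox γ u → ∑ k ∈ range K, L k * u k ≤ B u) (hy : 0 < y)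
    (hh : SeqBox γ h) (hf : MemFlow B y h) {k : ℕ} (hkK : k ∈ range K) :
    L k * h k ^ 3 * ∑ l ∈ range k, Real.sqrt ((k : ℝ) / ((k : ℝ) + l + 1)) ≤ 1 := by
  have hhk := (hh k).1
  have hwin := sum_mul_readWindow_le_invSq hmono hL hb hlo hdom hy hh hf k
  have hsingle : L k * h k * ∑ l ∈ range k, Real.sqrt ((k : ℝ) / ((k : ℝ) + l + 1)) ≤
      ∑ k' ∈ range K, L k' * h k' * ∑ l ∈ range k, Real.sqrt ((k' : ℝ) / ((k' : ℝ) + l + 1)) :=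
    single_le_sum (f := fun k' => L k' * h k' * ∑ l ∈ range k, Real.sqrt ((k' : ℝ) / ((k' : ℝ) + l + 1)))
      (fun k' _ => mul_nonneg (mul_nonneg (hL k') (hh k').1.le) (readWindow_nonneg k' k)) hkK
  have h1 : L k * h k * ∑ l ∈ range k, Real.sqrt ((k : ℝ) / ((k : ℝ) + l + 1)) ≤ 1 / h k ^ 2 := hsingle.trans hwin
  have := mul_le_mul_of_nonneg_left h1 (by positivity : (0 : ℝ) ≤ h k ^ 2)
  calc L k * h k ^ 3 * ∑ l ∈ range k, Real.sqrt ((k : ℝ) / ((k : ℝ) + l + 1))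
      = h k ^ 2 * (L k * h k * ∑ l ∈ range k, Real.sqrt ((k : ℝ) / ((k : ℝ) + l + 1))) := by ring
    _ ≤ h k ^ 2 * (1 / h k ^ 2) := this
    _ = 1 := by field_simp

/-! ## §3 The window weights dominate (E64i)'s weights -/

/-- Each summand of the window sum at scale `j` is at least the last one: `√(k∕(k+j)) ≤ √(k∕(k+l+1))` for `l < j`. [folklore] -/
theorem sqrt_le_readWindow_summand {k j l : ℕ} (hl : l ∈ range j) :
    Real.sqrt ((k : ℝ) / ((k : ℝ) + j)) ≤ Real.sqrt ((k : ℝ) / ((k : ℝ) + l + 1)) := by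
  have hlj : l + 1 ≤ j := mem_range.mp hl
  have hlj' : (l : ℝ) + 1 ≤ j := by exact_mod_cast hlj
  have hk : (0 : ℝ) ≤ k := Nat.cast_nonneg k
  have hl0 : (0 : ℝ) ≤ l := Nat.cast_nonneg l
  apply Real.sqrt_le_sqrt
  exact div_le_div_of_nonneg_left hk (by positivity) (by linarith)

/-- Hence `j·√(k∕(k+j)) ≤ S_{k,j}`. [folklore] -/
theorem mul_sqrt_le_readWindow (k j : ℕ) :
    (j : ℝ) * Real.sqrt ((k : ℝ) / ((k : ℝ) + j)) ≤ ∑ l ∈ range j, Real.sqrt ((k : ℝ) / ((k : ℝ) + l + 1)) := by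
  have := sum_le_sum fun l (hl : l ∈ range j) => sqrt_le_readWindow_summand (k := k) hl
  rwa [sum_const, card_range, nsmul_eq_mul] at this

/-- **THE WINDOW WEIGHTS DOMINATE (E64i)'s WEIGHTS**: for `j ≥ 1` and every `k`, (E64i)'s weight (`√(k∕j)` for `k ≤ j`, `j∕k` for `k > j`) is at most
`√2` times the window weight (`S_{k,j}∕j`, resp. `S_{k,j}∕k`) — since `S_{k,j} ≥ j·√(k∕(k+j))` and `k + j ≤ 2·max(k,j)`.  So §2 (right side `1`) implies
(E64i) (right side `√2`) termwise; on the diagonal the gain is `S_{j,j}∕(j∕√2) → 2√2(√2−1) = 1.17`, for `k ≪ j` it tends to `2√2`, for `k ≫ j` to `√2`.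
[folklore] -/
theorem weight_le_sqrt_two_mul_window_weight {j : ℕ} (hj : 1 ≤ j) (k : ℕ) :
    (if k ≤ j then Real.sqrt ((k : ℝ) / j) else (j : ℝ) / k) ≤
      Real.sqrt 2 * (if k ≤ j then (∑ l ∈ range j, Real.sqrt ((k : ℝ) / ((k : ℝ) + l + 1))) / j
        else (∑ l ∈ range j, Real.sqrt ((k : ℝ) / ((k : ℝ) + l + 1))) / k) := by
  have hjr : (0 : ℝ) < j := by exact_mod_cast hj
  have hk : (0 : ℝ) ≤ k := Nat.cast_nonneg k
  have hS := mul_sqrt_le_readWindow k j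
  set S : ℝ := ∑ l ∈ range j, Real.sqrt ((k : ℝ) / ((k : ℝ) + l + 1)) with hS_def
  have hs2 : Real.sqrt 2 * Real.sqrt (1 / 2) = 1 := by
    rw [← Real.sqrt_mul (by norm_num)]; norm_num
  by_cases hkj : k ≤ j
  · rw [if_pos hkj, if_pos hkj]
    have hkj' : (k : ℝ) ≤ j := by exact_mod_cast hkj
    -- √(k/j) = √2·√(k/(2j)) ≤ √2·√(k/(k+j)) ≤ √2·S/j
    have h1 : Real.sqrt ((k : ℝ) / j) ≤ Real.sqrt 2 * Real.sqrt ((k : ℝ) / ((k : ℝ) + j)) := by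
      have e : Real.sqrt ((k : ℝ) / j) = Real.sqrt 2 * Real.sqrt ((k : ℝ) / (2 * j)) := by
        rw [← Real.sqrt_mul (by norm_num)]
        congr 1
        field_simp
      rw [e]
      refine mul_le_mul_of_nonneg_left (Real.sqrt_le_sqrt ?_) (Real.sqrt_nonneg 2)
      exact div_le_div_of_nonneg_left hk (by positivity) (by linarith)
    have h2 : Real.sqrt ((k : ℝ) / ((k : ℝ) + j)) ≤ S / j := by
      rw [le_div_iff₀ hjr]; linarith
    exact h1.trans (mul_le_mul_of_nonneg_left h2 (Real.sqrt_nonneg 2))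
  · rw [if_neg hkj, if_neg hkj]
    have hjk : j < k := Nat.lt_of_not_le hkj
    have hkr : (0 : ℝ) < k := by exact_mod_cast (Nat.zero_le j).trans_lt hjk
    have hjk' : (j : ℝ) ≤ k := by exact_mod_cast hjk.le
    -- j/k = √2·(j/k)·√(1/2) ≤ √2·(j/k)·√(k/(k+j)) ≤ √2·S/k
    have hhalf : Real.sqrt (1 / 2) ≤ Real.sqrt ((k : ℝ) / ((k : ℝ) + j)) := by
      apply Real.sqrt_le_sqrt
      rw [div_le_div_iff₀ (by norm_num) (by positivity)]
      linarith
    have h1 : (j : ℝ) / k ≤ Real.sqrt 2 * ((j : ℝ) / k * Real.sqrt ((k : ℝ) / ((k : ℝ) + j))) := by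
      have := mul_le_mul_of_nonneg_left hhalf (by positivity : (0 : ℝ) ≤ Real.sqrt 2 * ((j : ℝ) / k))
      calc (j : ℝ) / k = Real.sqrt 2 * Real.sqrt (1 / 2) * ((j : ℝ) / k) := by rw [hs2, one_mul]
        _ = Real.sqrt 2 * ((j : ℝ) / k) * Real.sqrt (1 / 2) := by ring
        _ ≤ Real.sqrt 2 * ((j : ℝ) / k) * Real.sqrt ((k : ℝ) / ((k : ℝ) + j)) := this
        _ = Real.sqrt 2 * ((j : ℝ) / k * Real.sqrt ((k : ℝ) / ((k : ℝ) + j))) := by ring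
    have h2 : (j : ℝ) / k * Real.sqrt ((k : ℝ) / ((k : ℝ) + j)) ≤ S / k := by
      rw [div_mul_eq_mul_div, div_le_div_iff_of_pos_right hkr]; exact hS
    exact h1.trans (mul_le_mul_of_nonneg_left h2 (Real.sqrt_nonneg 2))

end Summit.QuantumFields.BalabanUV.Beta.EriceRemainderEnclosureHistoryAutonomyComparisonLoadBudgetWindow

end
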